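import Summits.BirchSwinnertonDyer.BirchSwinnertonDyer.Theorems.ClassRecordThreeCartanSupplyHeckeFamily
import Summits.BirchSwinnertonDyer.BirchSwinnertonDyer.Theorems.ClassRecordThreeCartanSupplyOneSidedTypeCut
import Summits.BirchSwinnertonDyer.BirchSwinnertonDyer.Theorems.ClassRecordThreeCartanSupplyCubicCharacterTables
import Summits.BirchSwinnertonDyer.BirchSwinnertonDyer.Theorems.ClassRecordThreeCartanNaturalRouteClosers
import Summits.BirchSwinnertonDyer.BirchSwinnertonDyer.Theorems.ClassRecordThreeEulerHalvesAtThreeCartanCarayolCuspLift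
import Summits.BirchSwinnertonDyer.BirchSwinnertonDyer.Theorems.ClassRecordThreeEulerHalvesAtThreeCartanCoverPrintClausesDescent
import HarnessLib

/-!
# Line `conductor` — crux 24801 `CartanOnePlaceDegreeLawAtThree` (NUM), generation 24 (lineage `cruxidea-stmt-BirchSwinnertonDyer-24801-1`; UNREGISTERED, W-79):
(LL) IS NOT A LEAF — the cover-invariant `V`-eigenform is killed by a CONDUCTOR ∕ RAMIFICATION contradiction from the inputs of record (DS) ∧ (JLᶜ); stubs 5 → 4

RECORD (2026-08-31): NUM ⟸ NUM♮ (32276) ⟸ (ISO)♮ ∧ (DS) ∧ (JLᶜ) (PICKED `Lines/petarea.lean` rev 8, untouched). Generation 22 (`Lines/doublecoset.lean`) cut (ISO)♮ to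
(MO1) ∧ (BCV) ∧ (VAN) (+ (FGT), (SPH), (HF♭) PROVED); its §A–§I now stand in the TREE as the nine `Theorems/ClassRecordThreeCartanSupply*.lean` modules
(namespace `…Theorems.CartanDoubleCoset`, cell bsd-stepL `k5-lift1`, 2026-08-31) and are IMPORTED here, not re-vendored. Generation 23 (`Lines/typecut.lean`
0f93f9bf2614071f) cut (BCV) ⟸ (PSV) ∧ (MO1) and (VAN) ⟸ (LL) ∧ (CV♭) ∧ (MO1) (§J, copied VERBATIM below under this namespace — Lines cannot import Lines), leaving FIVE
stubs {(MO1), (PSV), (LL), (CV♭), (DS) ∧ (JLᶜ)}.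

THIS NODE (§K, NEW, sorry-free) PROVES generation 23's leaf (LL) `NoCoverInvariantEigenform` — «a good-Hecke `a_ℓ(V)`-eigenform `F` of split-Cartan level whose
restriction to `Γ̄(q)` is invariant under the whole cover unit group `ι(O₀'¹)` is zero» — from the two inputs the composition ALREADY carries, (DS)
`DeligneSerre1974.thm61_exists_adicGaloisRep` and (JLᶜ) `jacquetLanglands_cartanCover_newform`:
* §K.3 `coverForm`: such an `F` IS a cusp form on `ι(O₀'¹)` (cusps transfer along the finite-index inclusion `Γ̄(q) ≤ ι(O₀'¹)`, `PrintClauses.finiteIndex_principalLevel_subgroupOf`);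
* §K.2 HECKE COMPATIBILITY `unitsHeckeFun_cover_eq_Os`: at every good prime `T_ℓ^{O₀'} F = Σ_i F ∣ α_i = T_ℓ^{O_s} F` — the simultaneous representatives `α_i` of §I
  (`SimRep`: `disj`, `cover`) represent `ι(O₀'¹)∖ι(O₀'(ℓ))`, and by §I.3 (`heckeFn_dockTorus_split_one`, `δ_i = wit_i⁻¹ α_i`, `wit_i ∈ ι(O₀'¹)`) also compute `T_ℓ^{O_s}`
  once `F` is `ι(O₀'¹)`-invariant; so `F` is an `a_ℓ(V)`-eigenform FOR THE COVER ORDER off the finite set `S = primeFactors(q·D·M·∏_C p)`;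
* (JLᶜ)`.exists_newform1`: a newform `f ∈ S₂(Γ₁(M_f))`, `ε_f = 1`, `M_f ∣ D·M·∏_{C∖q} p²` — so `q ∤ M_f` (`CartanCarayol.not_dvd_of_dvd_coverLevel`) — with `a_ℓ(f) = a_ℓ(V)`
  for all primes `ℓ ∉ S`;
* §K.1 `false_of_newform_coeff_eq_lFunction`: IMPOSSIBLE — a maximal ideal `𝔐 ∋ 3` of `𝓞_f` (`exists_maximal_ideal_over_ker`), `k = 𝓞_f∕𝔐`; Deligne's `ρ̄_{f,𝔐}`
  (DS, `exists_isGaloisRepOfNewform1Int_semisimple_of_thm61`) and `ρ̄_{V,3} ⊗ k` (semisimple by `Surj V 3`) have the same Frobenius polynomials `X² − ā_ℓ X + ℓ̄` at almost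
  all places, hence are isomorphic (Brauer–Nesbitt–Čebotarev, `FramedGaloisRep.nonempty_equiv_of_hasFrobCharpolyAt_eventually_of_discrete'`), so `ρ̄_{V,3}` is unramified
  at the place over `q ∤ 3M_f` — contradicting ADDITIVE reduction at the Cartan place `q ∈ C` (`CartanCarayol.hasAdditiveReductionAt_of_mem_cartanPlaces`,
  `IsTorsionGaloisRep.not_isUnramifiedAt_baseChange_of_hasAdditiveReductionAt`). This is the characteristic-zero shadow of the chain's own mod-`3` obstruction (OBS)
  (`CartanCarayol.modular_of_congruentNewform` ∘ `noModThreePeriodCharacterExtension_of_modular`), run on an honest cusp form instead of a period cochain.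
Consequently (VAN) ⟸ (CV♭) ∧ (MO1) ∧ ((DS) ∧ (JLᶜ)) (`nonsplitTorusCubicVanishing_of_conductor`) and the crux decl BY NAME follows from FOUR stubs
{(MO1) `stub_splitLevelMultiplicityOne`, (PSV) `stub_cubicPrincipalSeriesVector`, (CV♭) `stub_nonsplitCubicVanishingFree`, (DS) ∧ (JLᶜ) `stub_galoisTransferInputs`}
(§5 `CartanOnePlaceDegreeLawAtThree_of_conductor` ∕ `'` ∕ `…Natural_of_conductor`, `_of_stubs` ∕ `_of_stubs'`). NO new leaf is introduced.

WHY NOVEL (lineage rule): generations 14–23 treated the split-side vanishing — (VAN)₁, then (L1S), then (LL) — as a representation-theoretic or print leaf («strong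
multiplicity one», «no level-lowering at exponent 2»); this node converts `ι(O₀'¹)`-invariance into a LEVEL statement (a newform of level prime to `q`) and kills it
with the RAMIFICATION of `ρ̄_{V,3}` at `q`, using only Deligne–Serre + Čebotarev already formalised for the (OBS) cut — no strong multiplicity one, no `IsNewformOf`,
no conductor–level theorem for the JL transfer is needed.

PIECES, D-0171 tags, KEEP/KILL, presearch and the must-fail probes: `Lines/conductor.md`. Load-bearing stubs after this node: (MO1) [classical, HARDEST in tree],
(CV♭) [BARRIER(print) = Deligne–Carayol; INSTRUMENTABLE], (PSV) [INSTRUMENTABLE], (DS) ∧ (JLᶜ) [inputs of record].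

PROVENANCE: §J (l. `section TypeCut` … `end TypeCut` minus §K) = `Lines/typecut.lean` 0f93f9bf2614071f §J.1–§J.5 BYTE-IDENTICAL (docstring of (LL) and the §J.4
heading retagged «proved in §K»; namespace `…Typecut` ↦ `…Conductor`); §A, §0–§3, §F, §H, §I are the tree modules `…Theorems.ClassRecordThreeCartanSupply*`
(imported); §K and §5 are new. Identifier `η` is not introduced (only the tree field `R.η`); no unsafe-reducibility options; sorries ONLY in the four `stub_*` of §4.

[cite: DeligneSerre1974, Thm. 6.1] [cite: JacquetLanglands1970, Thm. 16.1] [cite: Serre1987, §1.2, (1.2.1)–(1.2.2)] [cite: SilvermanAEC2009, Thm. VII.6.1]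
[cite: DarmonDiamondTaylor1995, §2.1] [cite: Carayol1986, Thm. (A)] [cite: DiamondShurman2005, Thm. 5.8.2, Thm. 9.6.5] [cite: ShimuraIATAF1971, §8.3 (8.3.4)]
[cite: Bump1997, Thm. 4.1.1, Prop. 4.1.2, Prop. 4.1.6] [cite: Langlands1973, Thm. 7.1] [cite: AtkinLi1978, Thm. 3.1] [cite: LoefflerWeinstein2011, Thm. 1.1]
[cite: Tunnell1983, Thm. p. 1277] [cite: Rohrlich1993, Prop. 2] [cite: DokchitserDokchitser2010, §3 Case 4c p. 14]
-/

set_option linter.dupNamespace false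
set_option autoImplicit false

noncomputable section

open scoped Classical MatrixGroups
open Matrix

namespace Summit.BirchSwinnertonDyer.BirchSwinnertonDyer.Cruxes.CartanOnePlaceDegreeLawAtThree.Conductor

open Summit.BirchSwinnertonDyer.BirchSwinnertonDyer.Theorems
open Summit.BirchSwinnertonDyer.BirchSwinnertonDyer.Theorems.CartanDegree (HasRatEigenvalue)
open Summit.BirchSwinnertonDyer.BirchSwinnertonDyer.Theorems.CartanTorusCubeCut (torusSubgroup mem_torusSubgroup lin linGL
  linGL_coe lin_comm torusSubgroup_isCyclic card_torusSubgroup)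
open Summit.BirchSwinnertonDyer.BirchSwinnertonDyer.Theorems.CartanCover (splitGen mem_splitTorus_iff)
open Summit.BirchSwinnertonDyer.BirchSwinnertonDyer.Theorems.CartanCover.Charext.InertHecke (upperUnip lowerUnip coe_upperUnip
  coe_lowerUnip upperUnip_mul upperUnip_zero exists_unip_factorization)
open scoped Pointwise ModularForm NumberField
open Module UpperHalfPlane
open Literature.NumberTheory.Automorphic WeierstrassCurve Literature.NumberTheory.EllipticCurves Literature.NumberTheory.EllipticCurves.ModularForms
open Literature.NumberTheory.EllipticCurves.Rank1Residual Summit.BirchSwinnertonDyer.Rank1Residual Literature.NumberTheory.GaloisRepresentations NumberField IsDedekindDomain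
open Summit.BirchSwinnertonDyer.BirchSwinnertonDyer.Theorems.CartanCover
open Summit.BirchSwinnertonDyer.BirchSwinnertonDyer.Theorems.CartanCover.CMRank
open Summit.BirchSwinnertonDyer.BirchSwinnertonDyer.Theorems.CartanTorusCubeCut
open Summit.BirchSwinnertonDyer.BirchSwinnertonDyer.Theorems.CartanNaturalChain
open Summit.BirchSwinnertonDyer.BirchSwinnertonDyer.Theorems.CartanDegree (cubicNewvectorChar HasRatEigenvalue)
open Summit.BirchSwinnertonDyer.BirchSwinnertonDyer.Theorems.CartanDoubleCoset

/-! ## §J Generation 23's TYPE CUT, verbatim (`Lines/typecut.lean` §J.1–§J.5; the §A–§I names it uses resolve to the tree's `…Theorems.CartanDoubleCoset`), with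
§K (NEW) inserted after §J.4 -/

section TypeCut

/-! ### §J.1 PROVED (finite group theory): `P² = 1`, Bruhat, character separation on the diagonal torus, THE BOREL EIGENLINE -/

section BorelLine

variable {q : ℕ} [Fact q.Prime]

/-- `P² = 1`. -/
theorem weylP_mul_weylP : (weylP : GL (Fin 2) (ZMod q)) * weylP = 1 := by
  apply Units.ext
  rw [Units.val_mul, coe_weylP, Units.val_one]
  ext i j
  fin_cases i <;> fin_cases j <;> simp [Matrix.mul_apply, Fin.sum_univ_two]

/-- the Weyl conjugate `P h(c) P = diag(1, c)` of `h(c)`. -/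
def diagL (c : (ZMod q)ˣ) : GL (Fin 2) (ZMod q) := weylP * diagU c * weylP

theorem coe_diagL (c : (ZMod q)ˣ) :
    ((diagL c : GL (Fin 2) (ZMod q)) : Matrix (Fin 2) (Fin 2) (ZMod q)) = !![1, 0; 0, (c : ZMod q)] := by
  rw [diagL, Units.val_mul, Units.val_mul, coe_weylP, coe_diagU]
  ext i j
  fin_cases i <;> fin_cases j <;> simp [Matrix.mul_apply, Fin.sum_univ_two]

theorem diagU_lower (c : (ZMod q)ˣ) : ((diagU c : GL (Fin 2) (ZMod q)) : Matrix (Fin 2) (Fin 2) (ZMod q)) 1 0 = 0 := by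
  rw [coe_diagU]; rfl

theorem diagL_lower (c : (ZMod q)ˣ) : ((diagL c : GL (Fin 2) (ZMod q)) : Matrix (Fin 2) (Fin 2) (ZMod q)) 1 0 = 0 := by
  rw [coe_diagL]; rfl

theorem upperUnip_lower (x : ZMod q) : ((upperUnip x : GL (Fin 2) (ZMod q)) : Matrix (Fin 2) (Fin 2) (ZMod q)) 1 0 = 0 := by
  rw [coe_upperUnip]; rfl

/-- THE TORUS COMMUTATION `h(c) · n(y) P = n(c y) P · h(c)^P`. -/
theorem diagU_mul_unip_weylP (c : (ZMod q)ˣ) (y : ZMod q) :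
    diagU c * (upperUnip y * weylP) = upperUnip ((c : ZMod q) * y) * weylP * diagL c := by
  rw [← mul_assoc, diagU_mul_unip, diagL, mul_assoc (upperUnip _) weylP, ← mul_assoc weylP (weylP * diagU c) weylP,
    ← mul_assoc weylP weylP (diagU c), weylP_mul_weylP, one_mul, mul_assoc]

/-- THE BRUHAT DECOMPOSITION: an element with non-zero lower-left entry is `n(x) · P · b` with `b` upper-triangular. -/
theorem bruhat_of_ne (g : GL (Fin 2) (ZMod q)) (h : (g : Matrix (Fin 2) (Fin 2) (ZMod q)) 1 0 ≠ 0) :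
    ∃ (x : ZMod q) (b : GL (Fin 2) (ZMod q)), (b : Matrix (Fin 2) (Fin 2) (ZMod q)) 1 0 = 0 ∧ g = upperUnip x * weylP * b := by
  set x : ZMod q := (g : Matrix (Fin 2) (Fin 2) (ZMod q)) 0 0 / (g : Matrix (Fin 2) (Fin 2) (ZMod q)) 1 0 with hx
  refine ⟨x, weylP * upperUnip (-x) * g, ?_, ?_⟩
  · have hxg : x * (g : Matrix (Fin 2) (Fin 2) (ZMod q)) 1 0 = (g : Matrix (Fin 2) (Fin 2) (ZMod q)) 0 0 := div_mul_cancel₀ _ h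
    rw [Units.val_mul, Units.val_mul, coe_weylP, coe_upperUnip]
    simp [Matrix.mul_apply, Fin.sum_univ_two]
    rw [← hxg]; ring
  · simp only [← mul_assoc]
    rw [mul_assoc (upperUnip x) weylP weylP, weylP_mul_weylP, mul_one, upperUnip_mul, add_neg_cancel, upperUnip_zero, one_mul]

variable {lam : GL (Fin 2) (ZMod q) → ℂ}

/-- a cubic Borel character is trivial on `N`. -/
theorem IsCubicBorelCharacter.unip (h : IsCubicBorelCharacter q lam) (x : ZMod q) : lam (upperUnip x) = 1 :=
  h.2.1 _ (upperUnip_lower x) ⟨1, one_ne_zero, by rw [coe_upperUnip]; simp⟩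

/-- **CHARACTER SEPARATION ON THE DIAGONAL TORUS**: a cubic Borel character `λ` differs from its Weyl conjugate at some `h(c)`:
`λ(h(c)) = x` with `x³ = 1`, `x ≠ 1`, and `λ(h(c)^P) = x⁻¹ ≠ x`. -/
theorem IsCubicBorelCharacter.exists_diagU_ne (h : IsCubicBorelCharacter q lam) :
    ∃ c : (ZMod q)ˣ, lam (diagU c) ≠ lam (diagL c) := by
  obtain ⟨hmul, hcube, t, h01, h10, hlt⟩ := h
  obtain ⟨c, hs01, hs10, hs00⟩ := diag_decomp t h01 h10
  refine ⟨c, fun heq => hlt ?_⟩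
  -- `t = h(c) · s` with `s` scalar-diagonal, `λ(s) = 1`, so `x := λ(h(c)) = λ(t)`
  have hs : lam ((diagU c)⁻¹ * t) = 1 := hcube _ hs10 ⟨1, one_ne_zero, by rw [one_pow, one_mul]; exact hs00⟩
  have ht : lam t = lam (diagU c) := by
    conv_lhs => rw [← mul_inv_cancel_left (diagU c) t]
    rw [hmul _ _ (diagU_lower c) hs10, hs, mul_one]
  -- `x³ = 1`
  have h3 : lam (diagU c) * lam (diagU c) * lam (diagU c) = 1 := by
    have hc3 : lam (diagU (c * c * c)) = 1 :=
      hcube _ (diagU_lower _) ⟨(c : ZMod q), c.ne_zero, by rw [coe_diagU]; simp; ring⟩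
    rw [← hmul _ _ (diagU_lower c) (diagU_lower c), diagU_mul, ← hmul _ _ (diagU_lower _) (diagU_lower c), diagU_mul]
    exact hc3
  -- `x · λ(h(c)^P) = λ(scalar c) = 1`
  have h2 : lam (diagU c) * lam (diagL c) = 1 := by
    have hprod : ((diagU c * diagL c : GL (Fin 2) (ZMod q)) : Matrix (Fin 2) (Fin 2) (ZMod q)) = !![(c : ZMod q), 0; 0, (c : ZMod q)] := by
      rw [Units.val_mul, coe_diagU, coe_diagL]
      ext i j
      fin_cases i <;> fin_cases j <;> simp [Matrix.mul_apply, Fin.sum_univ_two]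
    rw [← hmul _ _ (diagU_lower c) (diagL_lower c)]
    refine hcube _ ?_ ⟨1, one_ne_zero, ?_⟩
    · rw [hprod]; rfl
    · rw [hprod]; simp
  -- if `x = λ(h(c)^P)` then `x² = 1 = x³`, so `x = 1`
  rw [← heq] at h2
  rw [ht]
  calc lam (diagU c) = lam (diagU c) * (lam (diagU c) * lam (diagU c)) := by rw [h2, mul_one]
    _ = 1 := by rw [← mul_assoc]; exact h3

/-- **(BLINE) THE BOREL EIGENLINE** [PROVED, any `ℂ[GL₂(𝔽_q)]`-module]: in the `G`-span of a `(B, λ)`-eigenvector `v` (`λ` cubic Borel) every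
`(B, λ)`-eigenvector is a multiple of `v` (Bruhat + `N`-average + torus character separation; Mackey's `⟨Res_B Ind_B^G λ, λ⟩ = 1` vector-wise). -/
theorem borelLine {W : Type*} [AddCommGroup W] [Module ℂ W] (ρ : Representation ℂ (GL (Fin 2) (ZMod q)) W)
    (hlam : IsCubicBorelCharacter q lam) {v : W}
    (hv : ∀ b : GL (Fin 2) (ZMod q), (b : Matrix (Fin 2) (Fin 2) (ZMod q)) 1 0 = 0 → ρ b v = lam b • v)
    {u : W} (hu : u ∈ Submodule.span ℂ (Set.range fun g : GL (Fin 2) (ZMod q) => ρ g v))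
    (hub : ∀ b : GL (Fin 2) (ZMod q), (b : Matrix (Fin 2) (Fin 2) (ZMod q)) 1 0 = 0 → ρ b u = lam b • u) :
    ∃ a : ℂ, u = a • v := by
  obtain ⟨c, hc⟩ := IsCubicBorelCharacter.exists_diagU_ne hlam
  have hq0 : (q : ℂ) ≠ 0 := by exact_mod_cast (Fact.out : q.Prime).ne_zero
  -- the Bruhat vectors `v_x = n(x) P v` and their sum `s`
  set vx : ZMod q → W := fun x => ρ (upperUnip x * weylP) v with hvx
  set s : W := ∑ x : ZMod q, vx x with hs
  -- (1) Bruhat: `ℂ[G] v ≤ span (v, v_x)`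
  have hspan : Submodule.span ℂ (Set.range fun g : GL (Fin 2) (ZMod q) => ρ g v) ≤ Submodule.span ℂ (insert v (Set.range vx)) := by
    refine Submodule.span_le.mpr ?_
    rintro _ ⟨g, rfl⟩
    show ρ g v ∈ Submodule.span ℂ (insert v (Set.range vx))
    by_cases hg : (g : Matrix (Fin 2) (Fin 2) (ZMod q)) 1 0 = 0
    · rw [hv g hg]
      exact Submodule.smul_mem _ _ (Submodule.subset_span (Set.mem_insert _ _))
    · obtain ⟨x, b, hb, rfl⟩ := bruhat_of_ne g hg
      rw [map_mul, Module.End.mul_apply, hv b hb, map_smul]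
      exact Submodule.smul_mem _ _ (Submodule.subset_span (Set.mem_insert_of_mem _ ⟨x, rfl⟩))
  -- (2) the `N`-average
  set A : W →ₗ[ℂ] W := ∑ y : ZMod q, ρ (upperUnip y) with hA
  have hA_apply : ∀ w : W, A w = ∑ y : ZMod q, ρ (upperUnip y) w := fun w => by
    simp [hA, LinearMap.sum_apply]
  have hA_eig : ∀ w : W, (∀ b : GL (Fin 2) (ZMod q), (b : Matrix (Fin 2) (Fin 2) (ZMod q)) 1 0 = 0 → ρ b w = lam b • w) →
      A w = (q : ℂ) • w := by
    intro w hw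
    rw [hA_apply]
    have h1 : ∀ y : ZMod q, ρ (upperUnip y) w = w := fun y => by rw [hw _ (upperUnip_lower y), IsCubicBorelCharacter.unip hlam y, one_smul]
    simp_rw [h1]
    rw [Finset.sum_const, Finset.card_univ, ZMod.card, ← Nat.cast_smul_eq_nsmul ℂ]
  have hA_vx : ∀ x : ZMod q, A (vx x) = s := by
    intro x
    rw [hA_apply]
    have h1 : ∀ y : ZMod q, ρ (upperUnip y) (vx x) = vx (y + x) := fun y => by
      simp only [hvx]
      rw [← Module.End.mul_apply, ← map_mul, ← mul_assoc, upperUnip_mul]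
    simp_rw [h1]
    exact Fintype.sum_equiv (Equiv.addRight x) _ _ (fun y => rfl)
  -- (3) `A u ∈ span {v, s}`
  have hAu : A u ∈ Submodule.span ℂ ({v, s} : Set W) := by
    have hle : (Submodule.span ℂ (insert v (Set.range vx))).map A ≤ Submodule.span ℂ ({v, s} : Set W) := by
      rw [Submodule.map_span_le]
      rintro w (rfl | ⟨x, rfl⟩)
      · rw [hA_eig _ hv]
        exact Submodule.smul_mem _ _ (Submodule.subset_span (by simp))
      · rw [hA_vx]
        exact Submodule.subset_span (by simp)
    exact hle ⟨u, hspan hu, rfl⟩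
  obtain ⟨a', b', hab⟩ := Submodule.mem_span_pair.mp hAu
  -- (4) `u = a v + b s`
  have hu_eq : u = ((q : ℂ)⁻¹ * a') • v + ((q : ℂ)⁻¹ * b') • s := by
    have h1 : (q : ℂ) • u = a' • v + b' • s := by rw [← hA_eig u hub, hab]
    calc u = (q : ℂ)⁻¹ • ((q : ℂ) • u) := by rw [smul_smul, inv_mul_cancel₀ hq0, one_smul]
      _ = _ := by rw [h1, smul_add, smul_smul, smul_smul]
  set a : ℂ := (q : ℂ)⁻¹ * a'
  set b : ℂ := (q : ℂ)⁻¹ * b'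
  -- (5) the diagonal torus: `h(c) v = λ(h(c)) v`, `h(c) s = λ(h(c)^P) s`
  have hts : ρ (diagU c) s = lam (diagL c) • s := by
    rw [hs, map_sum, Finset.smul_sum]
    have h1 : ∀ y : ZMod q, ρ (diagU c) (vx y) = lam (diagL c) • vx ((c : ZMod q) * y) := fun y => by
      simp only [hvx]
      rw [← Module.End.mul_apply, ← map_mul, diagU_mul_unip_weylP, map_mul, Module.End.mul_apply, hv _ (diagL_lower c), map_smul]
    simp_rw [h1]
    rw [← Equiv.sum_comp (Units.mulLeft c) (fun y : ZMod q => lam (diagL c) • vx y)]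
    rfl
  have htu := hub _ (diagU_lower c)
  rw [hu_eq, map_add, map_smul, map_smul, hv _ (diagU_lower c), hts] at htu
  have key : (b * (lam (diagU c) - lam (diagL c))) • s = 0 := by
    have e : (b * (lam (diagU c) - lam (diagL c))) • s =
        -(a • lam (diagU c) • v + b • lam (diagL c) • s - lam (diagU c) • (a • v + b • s)) := by
      module
    rw [e, htu, sub_self, neg_zero]
  rcases smul_eq_zero.mp key with hb | hs0
  · rcases mul_eq_zero.mp hb with hb | hb
    · exact ⟨a, by rw [hu_eq, hb, zero_smul, add_zero]⟩
    · exact absurd (sub_eq_zero.mp hb) hc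
  · exact ⟨a, by rw [hu_eq, hs0, smul_zero, add_zero]⟩

end BorelLine

/-! ### §J.2 PROVED: eigen-components along a stable direct sum, and (BGEN) «a Borel eigenline whose `G`-span MEETS a stable submodule lies in it» -/

variable {D M : ℕ} {C : Finset ℕ} {X : CartanLevelCurveData D M C} {q : ℕ} [Fact q.Prime]

/-- **THE COMMUTATOR TRICK for eigenvectors** (`fixed_components` with an eigenvalue): if `u₁ + u₂` is a `c`-eigenvector of `t`, `u₁ ∈ σ`, `u₂ ∈ σ'`, both
`G`-stable with `σ ⊓ σ' = ⊥`, then so are `u₁` and `u₂`. -/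
theorem eigen_components (R : CoverReduction X q) {σ σ' : Submodule ℂ R.IndCuspForm}
    (hσ : ∀ g : GL (Fin 2) (ZMod q), ∀ F ∈ σ, R.indRep g F ∈ σ) (hσ' : ∀ g : GL (Fin 2) (ZMod q), ∀ F ∈ σ', R.indRep g F ∈ σ')
    (hinf : σ ⊓ σ' = ⊥) {u₁ u₂ : R.IndCuspForm} (hu₁ : u₁ ∈ σ) (hu₂ : u₂ ∈ σ') {t : GL (Fin 2) (ZMod q)} {c : ℂ}
    (ht : R.indRep t (u₁ + u₂) = c • (u₁ + u₂)) : R.indRep t u₁ = c • u₁ ∧ R.indRep t u₂ = c • u₂ := by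
  rw [map_add, smul_add] at ht
  have h1 : R.indRep t u₁ - c • u₁ ∈ σ := Submodule.sub_mem _ (hσ t u₁ hu₁) (Submodule.smul_mem _ _ hu₁)
  have h2 : c • u₂ - R.indRep t u₂ ∈ σ' := Submodule.sub_mem _ (Submodule.smul_mem _ _ hu₂) (hσ' t u₂ hu₂)
  have he : R.indRep t u₁ - c • u₁ = c • u₂ - R.indRep t u₂ := by
    rw [sub_eq_sub_iff_add_eq_add, ht]
    exact add_comm _ _
  have hmem : R.indRep t u₁ - c • u₁ ∈ σ ⊓ σ' := ⟨h1, he ▸ h2⟩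
  rw [hinf, Submodule.mem_bot, sub_eq_zero] at hmem
  refine ⟨hmem, ?_⟩
  have h3 : c • u₂ - R.indRep t u₂ = 0 := by rw [← he, hmem, sub_self]
  exact (sub_eq_zero.mp h3).symm

/-- **(BGEN) THE BOREL EIGENLINE MEETS ⟹ LIES IN** [PROVED]: `v` a `(B, λ)`-eigenvector (`λ` cubic Borel) of the induced module, `Y` a `G`-stable subspace;
if `ℂ[G]·v ⊓ Y ≠ 0` then `v ∈ Y` (Maschke complement of `ℂ[G]·v ⊓ Y`, `eigen_components`, (BLINE)). -/
theorem mem_of_borelLine_meets (R : CoverReduction X q) {lam : GL (Fin 2) (ZMod q) → ℂ} (hlam : IsCubicBorelCharacter q lam)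
    {v : R.IndCuspForm} (hv : ∀ b : GL (Fin 2) (ZMod q), (b : Matrix (Fin 2) (Fin 2) (ZMod q)) 1 0 = 0 → R.indRep b v = lam b • v)
    {Y : Submodule ℂ R.IndCuspForm} (hY : ∀ g : GL (Fin 2) (ZMod q), ∀ F ∈ Y, R.indRep g F ∈ Y)
    {u : R.IndCuspForm} (huU : u ∈ R.spanG v) (huY : u ∈ Y) (hu0 : u ≠ 0) : v ∈ Y := by
  haveI : NeZero ((Nat.card (GL (Fin 2) (ZMod q)) : ℂ)) := ⟨Nat.cast_ne_zero.mpr Nat.card_pos.ne'⟩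
  have hUst : ∀ g : GL (Fin 2) (ZMod q), ∀ F ∈ R.spanG v, R.indRep g F ∈ R.spanG v := fun g F hF => R.indRep_mem_spanG v g hF
  have hσst : ∀ g : GL (Fin 2) (ZMod q), ∀ F ∈ R.spanG v ⊓ Y, R.indRep g F ∈ R.spanG v ⊓ Y :=
    fun g F hF => ⟨hUst g F hF.1, hY g F hF.2⟩
  let σ : Subrepresentation R.indRep := ⟨R.spanG v ⊓ Y, fun g F hF => hσst g F hF⟩
  obtain ⟨σ', hc⟩ := exists_isCompl σ
  have hinf : (R.spanG v ⊓ Y) ⊓ σ'.toSubmodule = ⊥ := congrArg Subrepresentation.toSubmodule hc.inf_eq_bot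
  have hsup : (R.spanG v ⊓ Y) ⊔ σ'.toSubmodule = ⊤ := congrArg Subrepresentation.toSubmodule hc.sup_eq_top
  have hvtop : v ∈ (R.spanG v ⊓ Y) ⊔ σ'.toSubmodule := by rw [hsup]; exact Submodule.mem_top
  obtain ⟨y, hy, z, hz, hsum⟩ := Submodule.mem_sup.mp hvtop
  have hσ'st : ∀ g : GL (Fin 2) (ZMod q), ∀ F ∈ σ'.toSubmodule, R.indRep g F ∈ σ'.toSubmodule :=
    fun g F hF => σ'.apply_mem_toSubmodule g hF
  -- `y` is a `(B, λ)`-eigenvector in `ℂ[G]·v`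
  have hyb : ∀ b : GL (Fin 2) (ZMod q), (b : Matrix (Fin 2) (Fin 2) (ZMod q)) 1 0 = 0 → R.indRep b y = lam b • y :=
    fun b hb => (eigen_components R hσst hσ'st hinf hy hz (by rw [hsum]; exact hv b hb)).1
  obtain ⟨a, ha⟩ := borelLine R.indRep hlam hv hy.1 hyb
  by_cases ha0 : a = 0
  · exfalso
    rw [ha0, zero_smul] at ha
    have hvz : v ∈ σ'.toSubmodule := by rw [← hsum, ha, zero_add]; exact hz
    have hle : R.spanG v ≤ σ'.toSubmodule := spanG_le_of_mem R hσ'st hvz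
    have hmem : u ∈ (R.spanG v ⊓ Y) ⊓ σ'.toSubmodule := ⟨⟨huU, huY⟩, hle huU⟩
    rw [hinf, Submodule.mem_bot] at hmem
    exact hu0 hmem
  · have hva : v = a⁻¹ • y := by rw [ha, smul_smul, inv_mul_cancel₀ ha0, one_smul]
    rw [hva]
    exact Submodule.smul_mem _ _ hy.2

/-! ### §J.3 PROVED: a `T_s`-fixed vector of an `a_ℓ(V)`-eigenmodule of the family `𝒯♭` (§I) is the docking of an `a_ℓ(V)`-eigenform of split-Cartan level
(the first half of `fixed_dependent_of_eigenModuleFn`: FIX ⟹ DOCK by strong approximation + the iff-docking (iii♭)) -/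

theorem exists_eigenform_of_fixed {V : WeierstrassCurve ℚ} [V.IsElliptic] (hq : q ∈ C) (R : CoverReduction X q)
    (Os : Submodule ℤ X.B) (hOs : Brandt.IsOrder X.B Os)
    (𝒯 : ℕ → (R.IndCuspForm →ₗ[ℂ] (GL (Fin 2) (ZMod q) → ℍ → ℂ)))
    (hiii : ∀ ℓ : ℕ, ℓ.Prime → ¬ ℓ ∣ q * (D * M * ∏ p ∈ C, p) →
        ∀ (F : CuspForm (R.levelOf (CartanTorusCubeCut.torusSubgroup (splitGen q))) 2) (a : ℂ),
          (unitsHeckeFun X.ι hOs ℓ (⇑F) = fun τ => a * F τ) ↔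
            𝒯 ℓ (R.dockTorus (CartanTorusCubeCut.torusSubgroup (splitGen q)) F) =
              a • coeLin R (R.dockTorus (CartanTorusCubeCut.torusSubgroup (splitGen q)) F))
    (𝓜 : Submodule ℂ R.IndCuspForm)
    (h𝓜 : ∀ ℓ : ℕ, ℓ.Prime → ¬ ℓ ∣ q * (D * M * ∏ p ∈ C, p) → ∀ w ∈ 𝓜, 𝒯 ℓ w = (((V.LFunction ℓ : ℤ)) : ℂ) • coeLin R w)
    {w : R.IndCuspForm} (hw : w ∈ 𝓜) (hfix : ∀ t ∈ CartanTorusCubeCut.torusSubgroup (splitGen q), R.indRep t w = w) :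
    ∃ F : CuspForm (R.levelOf (CartanTorusCubeCut.torusSubgroup (splitGen q))) 2,
      w = R.dockTorus (CartanTorusCubeCut.torusSubgroup (splitGen q)) F ∧
      ∀ ℓ : ℕ, ℓ.Prime → ¬ ℓ ∣ q * (D * M * ∏ p ∈ C, p) →
        unitsHeckeFun X.ι hOs ℓ (⇑F) = fun τ => ((V.LFunction ℓ : ℤ) : ℂ) * F τ := by
  have hfull : ∀ g, g ∈ R.torusCoset (CartanTorusCubeCut.torusSubgroup (splitGen q)) := mem_torusCoset_split R hq
  refine ⟨fixedForm R _ w hfix, eq_dockTorus_of_fixed R _ hfull w hfix, fun ℓ hℓ hnd => ?_⟩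
  apply (hiii ℓ hℓ hnd _ _).mpr
  rw [← eq_dockTorus_of_fixed R _ hfull w hfix]
  exact h𝓜 ℓ hℓ hnd w hw

/-! ### §J.4 Generation 23's three `Q`-free statements (verbatim): (PSV) and (CV♭) stay leaves (stubs in §4); (LL) is PROVED in §K -/

/-- **(PSV) CUBIC PRINCIPAL-SERIES VECTOR at `q ≡ 1 (3)`** [NEW LEAF; local–global, principal-series regime; `Q`-FREE; INSTRUMENTABLE; print =
Tate (`3 ∣ c_q`, `q ∤ 6N/q²` ⟹ IV ∕ IV*, tame inertia of order `3`) + local Langlands (`π_{V,q} ≅ PS(χ₃ε, χ₃⁻¹ε⁻¹)`) + local–global compatibility + the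
ONE-dimensional `T_s`-fixed line of `π^{K(q)} ≅ Ind_B^G(χ₃ ⊠ χ₃⁻¹)` (Mackey, three `(B, T_s)` double cosets) — NO multiplicity one off `q`]. Under the crux's
binders at `q` and a presentation of a split order `O_s`: there are a cubic Borel character `λ`, a NON-ZERO `(B, λ)`-eigenvector `v` of the induced module and
a NON-ZERO `a_ℓ(V)`-eigenform `F` of split-Cartan level (`T_ℓ^{O_s}`, good `ℓ`) whose diagonal-torus docking lies in `ℂ[G]·v` (print: the docking is a pure
tensor `x₀ ⊗ m`, `v := v₀ ⊗ m`). NO `Q`, NO `IsMinimalFor`. Why it might fail: only through a mismatch between the tree's `unitsHeckeFun` ∕ `dockTorus`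
conventions and the adelic newvector. [cite: Langlands1973, Thm. 7.1] [cite: Carayol1986, Thm. (A)] [cite: AtkinLi1978, Thm. 3.1] [cite: Rohrlich1993, Prop. 2]
[cite: DokchitserDokchitser2010, §3 Case 4c p. 14] [cite: Bump1997, Thm. 4.1.1] [cite: LoefflerWeinstein2011, Thm. 1.1] -/
def CubicPrincipalSeriesVector : Prop :=
  ∀ (V : WeierstrassCurve ℚ) [V.IsElliptic] [V.IsGloballyMinimal], Surj V 3 →
    ∀ (N D M : ℕ) (C : Finset ℕ) (q : ℕ) [Fact q.Prime]
      (X : CartanLevelCurveData D M C) (hq : q ∈ C) (R : CoverReduction X q),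
      V.conductorNorm ℤ = N → D * M * ∏ p ∈ C, p ^ 2 = N → q ≠ 3 → ¬ q ^ 3 ∣ N →
      3 ∣ (V.baseChange ℚ_[q]).localTamagawaNumber ℤ_[q] → q % 3 = 1 →
      ∀ (Os : Submodule ℤ X.B) (hOs : Brandt.IsOrder X.B Os),
        (∀ m : Matrix (Fin 2) (Fin 2) ℝ, (∃ x ∈ Os, X.ι x = m) ↔
          ∃ y : coverSubring X q, (R.red y) 0 1 = 0 ∧ (R.red y) 1 0 = 0 ∧ X.ι (y : X.B) = m) →
        ∃ (lam : GL (Fin 2) (ZMod q) → ℂ) (v : R.IndCuspForm)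
          (F : CuspForm (R.levelOf (CartanTorusCubeCut.torusSubgroup (splitGen q))) 2),
          v ≠ 0 ∧ IsCubicBorelCharacter q lam ∧
          (∀ b : GL (Fin 2) (ZMod q), (b : Matrix (Fin 2) (Fin 2) (ZMod q)) 1 0 = 0 → R.indRep b v = lam b • v) ∧
          F ≠ 0 ∧
          (∀ ℓ : ℕ, ℓ.Prime → ¬ ℓ ∣ q * (D * M * ∏ p ∈ C, p) →
            unitsHeckeFun X.ι hOs ℓ (⇑F) = fun τ => ((V.LFunction ℓ : ℤ) : ℂ) * F τ) ∧
          R.dockTorus (CartanTorusCubeCut.torusSubgroup (splitGen q)) F ∈ R.spanG v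

/-- **(LL) NO COVER-INVARIANT `V`-EIGENFORM** [leaf of generation 23 — PROVED IN THIS NODE (§K.4 `noCoverInvariantEigenform_of_facts`, from (DS) ∧ (JLᶜ));
statement verbatim; generation 23's gloss follows: modular; `Q`-FREE, TYPE-FREE, regime-free; ATTACKABLE: (JLᶜ) `jacquetLanglands_cartanCover_newform`
moves a good-Hecke eigenform of level `ι(O₀'¹)` to a classical newform of level `∣ D·M·∏_{C∖q} p²` (prime to `q`); `V` is modular of conductor `N`, `q² ∣ N`
(`exists_isNewformOf`, `IsNewformOf.level_eq_conductorNorm`); strong multiplicity one + isogeny-invariance of the conductor — no level-lowering at exponent `2`].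
Under the crux's binders: an `a_ℓ(V)`-eigenform of split-Cartan level whose restriction to `Γ̄(q)` is invariant under the whole cover unit group `O₀'¹` is ZERO.
Why it might fail: only if `unitsHeckeFun` at level `O_s` and at level `O₀'` disagree on `O₀'¹`-invariant forms at some good `ℓ` (coset bookkeeping), making
(JLᶜ) inapplicable as typed. [cite: JacquetLanglands1970, Thm. 16.1] [cite: Carayol1986, Thm. (A)] [cite: DiamondShurman2005, Thm. 5.8.2] [cite: AtkinLehner1970, Thm. 5] -/
def NoCoverInvariantEigenform : Prop :=
  ∀ (V : WeierstrassCurve ℚ) [V.IsElliptic] [V.IsGloballyMinimal], Surj V 3 →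
    ∀ (N D M : ℕ) (C : Finset ℕ) (q : ℕ) [Fact q.Prime]
      (X : CartanLevelCurveData D M C) (hq : q ∈ C) (R : CoverReduction X q),
      V.conductorNorm ℤ = N → D * M * ∏ p ∈ C, p ^ 2 = N → q ≠ 3 → ¬ q ^ 3 ∣ N →
      3 ∣ (V.baseChange ℚ_[q]).localTamagawaNumber ℤ_[q] →
      ∀ (Os : Submodule ℤ X.B) (hOs : Brandt.IsOrder X.B Os),
        (∀ m : Matrix (Fin 2) (Fin 2) ℝ, (∃ x ∈ Os, X.ι x = m) ↔
          ∃ y : coverSubring X q, (R.red y) 0 1 = 0 ∧ (R.red y) 1 0 = 0 ∧ X.ι (y : X.B) = m) →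
        ∀ F : CuspForm (R.levelOf (CartanTorusCubeCut.torusSubgroup (splitGen q))) 2,
          (∀ ℓ : ℕ, ℓ.Prime → ¬ ℓ ∣ q * (D * M * ∏ p ∈ C, p) →
            unitsHeckeFun X.ι hOs ℓ (⇑F) = fun τ => ((V.LFunction ℓ : ℤ) : ℂ) * F τ) →
          (∀ γ : coverUnits X q,
            coverRep X q γ (R.restrictLevel (CartanTorusCubeCut.torusSubgroup (splitGen q)) F) =
              R.restrictLevel (CartanTorusCubeCut.torusSubgroup (splitGen q)) F) →
          F = 0

/-- **(CV♭) NON-SPLIT CUBIC VANISHING, `Q`-FREE, at `q ≡ 2 (3)`** [NEW LEAF; local–global, cuspidal regime; UNDECIDED ∕ BARRIER(print) = supercuspidal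
local–global compatibility: `3 ∣ c_q`, `q ≡ 2 (3)` ⟹ `π_{V,q} = π(θ₃)` of depth zero and `Res_{T_η} π(θ₃)^{K(q)}` omits exactly the cubic characters `θ₃^{±1}`;
INSTRUMENTABLE]. Under the crux's binders: if `v` is a `T_η`-eigenvector with a CUBIC torus character and `ℂ[G]·v` contains the diagonal docking of a NON-ZERO
`a_ℓ(V)`-eigenform of split-Cartan level, then `v = 0` (print: the `G`-equivariant good-Hecke projection of `v` to the `V`-part is cubic `T_η`-eigen, hence `0`,
yet its span contains the docking). NO `Q`, NO `IsMinimalFor`, NO irreducibility. Why it might fail: a cubic `T_η`-eigenvector OUTSIDE the `V`-part whose span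
contains a `V`-eigen docking — excluded in print by the Hecke-isotypic decomposition of the induced module (semisimplicity), not yet in tree at level `Γ̄(q)`.
[cite: Carayol1986, Thm. (A)] [cite: JamesLiebeck2001, Thm. 28.5] [cite: Tunnell1983, Thm. p. 1277] [cite: Rohrlich1993, Prop. 2] [cite: LoefflerWeinstein2011, Thm. 1.1]
[cite: Bump1997, Prop. 4.1.6] -/
def NonsplitCubicVanishingFree : Prop :=
  ∀ (V : WeierstrassCurve ℚ) [V.IsElliptic] [V.IsGloballyMinimal], Surj V 3 →
    ∀ (N D M : ℕ) (C : Finset ℕ) (q : ℕ) [Fact q.Prime]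
      (X : CartanLevelCurveData D M C) (hq : q ∈ C) (R : CoverReduction X q),
      V.conductorNorm ℤ = N → D * M * ∏ p ∈ C, p ^ 2 = N → q ≠ 3 → ¬ q ^ 3 ∣ N →
      3 ∣ (V.baseChange ℚ_[q]).localTamagawaNumber ℤ_[q] → q % 3 = 2 →
      ∀ (Os : Submodule ℤ X.B) (hOs : Brandt.IsOrder X.B Os),
        (∀ m : Matrix (Fin 2) (Fin 2) ℝ, (∃ x ∈ Os, X.ι x = m) ↔
          ∃ y : coverSubring X q, (R.red y) 0 1 = 0 ∧ (R.red y) 1 0 = 0 ∧ X.ι (y : X.B) = m) →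
        ∀ (ν : GL (Fin 2) (ZMod q) → ℂ) (v : R.IndCuspForm)
          (F : CuspForm (R.levelOf (CartanTorusCubeCut.torusSubgroup (splitGen q))) 2),
          IsCubicTorusCharacter R.η ν →
          (∀ t ∈ CartanTorusCubeCut.torusSubgroup R.η, R.indRep t v = ν t • v) →
          F ≠ 0 →
          (∀ ℓ : ℕ, ℓ.Prime → ¬ ℓ ∣ q * (D * M * ∏ p ∈ C, p) →
            unitsHeckeFun X.ι hOs ℓ (⇑F) = fun τ => ((V.LFunction ℓ : ℤ) : ℂ) * F τ) →
          R.dockTorus (CartanTorusCubeCut.torusSubgroup (splitGen q)) F ∈ R.spanG v →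
          v = 0


/-! ### §K PROVED (generation 24, NEW): (LL) IS NOT A LEAF — `NoCoverInvariantEigenform` from (JLᶜ) ∧ (DS) by a CONDUCTOR ∕ RAMIFICATION contradiction -/

/-! #### §K.1 The Galois contradiction: no newform of level prime to the Cartan place `q` has `a_ℓ(f) = a_ℓ(V)` at almost all primes -/

section Galois

open CongruenceSubgroup Rat.HeightOneSpectrum

/-- **No newform of level prime to `q` is good-Hecke congruent (indeed equal) to `V` — residual form.** For ANY discrete field `k` receiving `j : 𝔽₃ → k` and a
coefficient map `ι_f : 𝓞_f → k`: if `f ∈ S₂(Γ₁(M_f))` is a newform with trivial character, `q ∤ M_f`, and `a_ℓ(f) = a_ℓ(V)` for all primes `ℓ` outside a finite set, then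
`False`. Deligne's `ρ_{f}` reduced along `ι_f` is semisimple, unramified outside `3 M_f`, with Frobenius polynomials `X² − ι_f(a_ℓ) X + ℓ`
(`DeligneSerre1974.exists_isGaloisRepOfNewform1Int_semisimple_of_thm61`); `ρ̄_{V,3} ⊗_j k` is semisimple (`Surj V 3`, `CartanCarayol.isSemisimple_baseChange_of_surj`) with the
same polynomials at the good places (`CartanCarayol.hasFrobCharpolyAt_baseChange_of_isTorsionGaloisRep`, `a_{ℓ_v}(V) = a_v(V)`, `#k_v = ℓ_v`); Brauer–Nesbitt–Čebotarev
(`FramedGaloisRep.nonempty_equiv_of_hasFrobCharpolyAt_eventually_of_discrete'`) makes them isomorphic, so `ρ̄_{V,3} ⊗ k` is unramified at the place over `q` — but `q ∈ C` is a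
place of ADDITIVE reduction (`CartanCarayol.hasAdditiveReductionAt_of_mem_cartanPlaces`, `IsTorsionGaloisRep.not_isUnramifiedAt_baseChange_of_hasAdditiveReductionAt`).
The characteristic-zero shadow of the tree's `CartanCarayol.modular_of_congruentNewform` ∘ `noModThreePeriodCharacterExtension_of_modular`.
[cite: DeligneSerre1974, Thm. 6.1] [cite: Serre1987, §1.2, (1.2.1)–(1.2.2)] [cite: SilvermanAEC2009, Thm. VII.6.1] [cite: DarmonDiamondTaylor1995, §2.1] -/
theorem false_of_newform_coeff_eq_lFunction_residual (h61 : DeligneSerre1974.thm61_exists_adicGaloisRep)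
    {V : WeierstrassCurve ℚ} [V.IsElliptic] (hS : Surj V 3)
    {N D M : ℕ} {C : Finset ℕ} {q : ℕ} [Fact q.Prime]
    (hq : q ∈ C) (hN : V.conductorNorm ℤ = N) (hDMC : D * M * ∏ p ∈ C, p ^ 2 = N) (hq3 : q ≠ 3)
    {Mf : ℕ} [NeZero Mf] {f : CuspForm (Gamma1 Mf) 2} (hf : IsNewform1 f) (hε : nebentypus f = 1) (hqMf : ¬ q ∣ Mf)
    (S : Finset ℕ) (hcoef : ∀ ℓ : ℕ, ℓ.Prime → ℓ ∉ S → (qExpansion 1 ⇑f).coeff ℓ = ((V.LFunction ℓ : ℤ) : ℂ))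
    (k : Type) [Field k] [TopologicalSpace k] [DiscreteTopology k] (j : ZMod 3 →+* k) (ιf : ↥(coeffCharIntegers f) →+* k) : False := by
  classical
  have hqp : q.Prime := Fact.out
  haveI : NumberField (coeffCharField f) := Literature.NumberTheory.EllipticCurves.GreenbergSelmer.numberField_coeffCharField_of_isNewform1 hf
  haveI : CharP k 3 := charP_of_injective_ringHom j.injective 3
  -- § the two mod-`3` Galois representations
  obtain ⟨ρ, hρ⟩ := V.exists_isTorsionGaloisRep 3
  obtain ⟨ρf, hgalf, hssf⟩ :=
    DeligneSerre1974.exists_isGaloisRepOfNewform1Int_semisimple_of_thm61 h61 le_rfl hf 3 ιf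
  have hssV := CartanCarayol.isSemisimple_baseChange_of_surj hS hρ k j
  -- § the cofinite conditions: good reduction, `v ∤ 3`, `ℓ_v ∤ 3 M_f`, `ℓ_v ∉ S`
  have hgood := V.eventually_hasGoodReductionAt (K := ℚ)
  have h3fin : ∀ᶠ v : HeightOneSpectrum (𝓞 ℚ) in Filter.cofinite, ((3 : ℕ) : 𝓞 ℚ) ∉ v.asIdeal := by
    rw [Filter.eventually_cofinite]
    simp only [not_not]
    exact HeightOneSpectrum.finite_setOf_natCast_mem (by norm_num)
  have hSfin : ∀ᶠ v : HeightOneSpectrum (𝓞 ℚ) in Filter.cofinite, ((primesEquiv v : Nat.Primes) : ℕ) ∉ {ℓ | ℓ ∣ Mf * 3} := by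
    rw [Filter.eventually_cofinite]
    simp only [not_not]
    refine (HeightOneSpectrum.finite_setOf_natCast_mem (R := 𝓞 ℚ) (ℓ := Mf * 3)
      (mul_ne_zero (NeZero.ne Mf) (by norm_num))).subset fun v hv ↦ ?_
    rw [Set.mem_setOf_eq, CartanCarayol.natCast_mem_asIdeal_iff_natGenerator_dvd]
    exact hv
  have hS₁ : ∀ᶠ v : HeightOneSpectrum (𝓞 ℚ) in Filter.cofinite, ((primesEquiv v : Nat.Primes) : ℕ) ∉ S := by
    rw [Filter.eventually_cofinite]
    simp only [not_not]
    exact (S.finite_toSet.preimage ((Nat.Primes.coe_nat_injective.comp primesEquiv.injective).injOn)).subset fun v hv ↦ hv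
  -- § equal Frobenius polynomials at all but finitely many places
  have hev : ∀ᶠ v : HeightOneSpectrum (𝓞 ℚ) in Filter.cofinite, ∃ P : Polynomial k,
      ρf.HasFrobCharpolyAt v P ∧
        FramedGaloisRep.HasFrobCharpolyAt v P (FramedRep.baseChange j continuous_of_discreteTopology ρ) := by
    filter_upwards [hgood, h3fin, hSfin, hS₁] with v hv h3v hvS hvS₁
    obtain ⟨-, P', hP', hchar⟩ := hgalf v hvS
    have hℓMf : ¬ ((primesEquiv v : Nat.Primes) : ℕ) ∣ Mf := fun h ↦ hvS (dvd_mul_of_dvd_left h 3)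
    -- the integral Hecke polynomial `X² − a_ℓ(V) X + ℓ`, `ℓ = ℓ_v`
    have hP : (Polynomial.X ^ 2 - Polynomial.C (((V.LFunction ((primesEquiv v : Nat.Primes) : ℕ) : ℤ)) : ↥(coeffCharIntegers f)) * Polynomial.X +
          Polynomial.C ((((primesEquiv v : Nat.Primes) : ℕ)) : ↥(coeffCharIntegers f))).map
          (algebraMap ↥(coeffCharIntegers f) (coeffCharField f)) = heckePolynomial f (primesEquiv v) := by
      apply Polynomial.map_injective (algebraMap (coeffCharField f) ℂ) (algebraMap (coeffCharField f) ℂ).injective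
      rw [Polynomial.map_map, map_heckePolynomial]
      have hεp : (nebentypus f (((primesEquiv v : Nat.Primes) : ℕ) : ZMod Mf) : ℂ) * (((primesEquiv v : Nat.Primes) : ℕ) : ℂ) ^ ((2 : ℤ) - 1) =
          ((primesEquiv v : Nat.Primes) : ℕ) := by
        rw [hε, MulChar.one_apply ((ZMod.isUnit_prime_iff_not_dvd (primesEquiv v).2).mpr hℓMf)]
        norm_num
      have hαC' : ((algebraMap (coeffCharField f) ℂ).comp (algebraMap ↥(coeffCharIntegers f) (coeffCharField f)))
          (((V.LFunction ((primesEquiv v : Nat.Primes) : ℕ) : ℤ)) : ↥(coeffCharIntegers f)) = (qExpansion 1 ⇑f).coeff ((primesEquiv v : Nat.Primes) : ℕ) := by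
        rw [map_intCast, hcoef _ (primesEquiv v).2 hvS₁]
      rw [hεp, Polynomial.map_add, Polynomial.map_sub, Polynomial.map_mul, Polynomial.map_pow, Polynomial.map_X, Polynomial.map_C,
        Polynomial.map_C, map_natCast, hαC']
    have hPP' := Polynomial.map_injective _ (NumberField.RingOfIntegers.coe_injective) (hP'.trans hP.symm)
    refine ⟨P'.map ιf, hchar, ?_⟩
    have h := CartanCarayol.hasFrobCharpolyAt_baseChange_of_isTorsionGaloisRep hρ k j hv h3v
    rw [natCard_residueField_adicCompletionIntegers v, ← V.lFunction_primesEquiv_eq_frobeniusTraceAt hv, map_intCast, map_natCast] at h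
    rw [hPP']
    simpa only [Polynomial.map_add, Polynomial.map_sub, Polynomial.map_mul, Polynomial.map_pow, Polynomial.map_X, Polynomial.map_C,
      map_natCast, map_intCast, Polynomial.map_intCast, Polynomial.map_natCast] using h
  -- § Brauer–Nesbitt–Čebotarev: `ρ̄_{f,λ} ≅ ρ̄_{V,3} ⊗ k`, so the latter is carried by `f` — unramified at the place over `q`
  obtain ⟨e⟩ := FramedGaloisRep.nonempty_equiv_of_hasFrobCharpolyAt_eventually_of_discrete' ρf
    (FramedRep.baseChange j continuous_of_discreteTopology ρ) hssf hssV hev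
  have hgal := hgalf.of_equiv e
  -- § contradiction with additive reduction at `q ∈ C`
  have hv := CartanCarayol.natCast_mem_asIdeal_primesEquiv_symm hqp
  have hadd := CartanCarayol.hasAdditiveReductionAt_of_mem_cartanPlaces V hq hN hDMC _ hv
  exact hρ.not_isUnramifiedAt_baseChange_of_hasAdditiveReductionAt hadd le_rfl (CartanCarayol.three_not_mem_of_natCast_mem hqp hq3 hv) j
    continuous_of_discreteTopology (hgal _ (CartanCarayol.primesEquiv_not_mem_dvd_mul_three hqp hq3 hqMf hv)).1

/-- **No newform of level prime to the Cartan place `q` has `a_ℓ(f) = a_ℓ(V)` at almost all primes** (`f` a newform on `Γ₁(M_f)` with trivial character,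
`q ∤ M_f`, `V` with `ρ̄_{V,3}` surjective and conductor `D·M·∏_C p²`, `q ∈ C`): take a maximal ideal `𝔐 ∋ 3` of `𝓞_f` (`exists_maximal_ideal_over_ker`, with `R = ℤ`),
`k = 𝓞_f ∕ 𝔐` (discrete, characteristic `3`), `j : 𝔽₃ → k`, `ι_f = (mod 𝔐)`, and apply the residual form. [cite: DeligneSerre1974, Thm. 6.1] [cite: Serre1987, §1.2] -/
theorem false_of_newform_coeff_eq_lFunction (h61 : DeligneSerre1974.thm61_exists_adicGaloisRep)
    {V : WeierstrassCurve ℚ} [V.IsElliptic] (hS : Surj V 3)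
    {N D M : ℕ} {C : Finset ℕ} {q : ℕ} [Fact q.Prime]
    (hq : q ∈ C) (hN : V.conductorNorm ℤ = N) (hDMC : D * M * ∏ p ∈ C, p ^ 2 = N) (hq3 : q ≠ 3)
    {Mf : ℕ} [NeZero Mf] {f : CuspForm (Gamma1 Mf) 2} (hf : IsNewform1 f) (hε : nebentypus f = 1) (hqMf : ¬ q ∣ Mf)
    (S : Finset ℕ) (hcoef : ∀ ℓ : ℕ, ℓ.Prime → ℓ ∉ S → (qExpansion 1 ⇑f).coeff ℓ = ((V.LFunction ℓ : ℤ) : ℂ)) : False := by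
  classical
  haveI : NumberField (coeffCharField f) := Literature.NumberTheory.EllipticCurves.GreenbergSelmer.numberField_coeffCharField_of_isNewform1 hf
  -- § a maximal ideal `𝔐 ∋ 3` of `𝓞_f` and its residue field (characteristic `3`, discrete)
  obtain ⟨-, 𝔐, h𝔐, -, h3𝔐, -⟩ := Literature.NumberTheory.ModularSymbols.exists_maximal_ideal_over_ker (R := ℤ) (coeffCharField f) (Int.castRingHom ℂ)
    (RingHom.injective_int _) (fun r ↦ by simp) Nat.prime_three (Int.castRingHom _)
  haveI : 𝔐.IsMaximal := h𝔐
  letI kF : Field (↥(coeffCharIntegers f) ⧸ 𝔐) := Ideal.Quotient.field 𝔐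
  letI kT : TopologicalSpace (↥(coeffCharIntegers f) ⧸ 𝔐) := ⊥
  haveI : DiscreteTopology (↥(coeffCharIntegers f) ⧸ 𝔐) := ⟨rfl⟩
  have h3k : ((3 : ℕ) : ↥(coeffCharIntegers f) ⧸ 𝔐) = 0 := by
    rw [← map_natCast (Ideal.Quotient.mk 𝔐), Ideal.Quotient.eq_zero_iff_mem]
    exact h3𝔐
  haveI : CharP (↥(coeffCharIntegers f) ⧸ 𝔐) 3 := (CharP.charP_iff_prime_eq_zero Nat.prime_three).mpr h3k
  exact false_of_newform_coeff_eq_lFunction_residual h61 hS hq hN hDMC hq3 hf hε hqMf S hcoef (↥(coeffCharIntegers f) ⧸ 𝔐)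
    (ZMod.castHom (dvd_refl 3) _) (Ideal.Quotient.mk 𝔐)

end Galois

/-! #### §K.2 HECKE COMPATIBILITY on cover-invariant forms: `T_ℓ^{O_s} F = Σ_i F ∣ α_i = T_ℓ^{O₀'} F` (the representatives `α_i` of §I serve both orders) -/

omit [Fact q.Prime] in
/-- the representatives `α_i ∈ ι(O(ℓ))` lie in `ι(O₀'(ℓ))` (`O ≤ O₀'`, `nrd α_i = ℓ`). -/
theorem α_mem_unitsHeckeSet_cover {ℓ : ℕ} (S : SimRep X q ℓ) (i : Quotient (X.heckeSetoid ℓ)) :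
    S.α i ∈ unitsHeckeSet X.ι (O := coverOrder X q) ℓ := by
  obtain ⟨x, hx, hxα⟩ := S.exists_mem_O i
  exact ⟨⟨x, le_coverOrder X q hx, hxα⟩, S.det_α i⟩

/-- the comparison map `Γ∖ι(O(ℓ)) → ι(O₀'¹)∖ι(O₀'(ℓ))`, `i ↦ [α_i]`. -/
def toCoverQuot {ℓ : ℕ} (S : SimRep X q ℓ) (i : Quotient (X.heckeSetoid ℓ)) :
    Quotient (unitsHeckeSetoid X.ι (isOrder_coverOrder X q) ℓ) :=
  Quotient.mk _ ⟨S.α i, α_mem_unitsHeckeSet_cover S i⟩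

omit [Fact q.Prime] in
/-- `i ↦ [α_i]` is a bijection onto `ι(O₀'¹)∖ι(O₀'(ℓ))` ((K2) `disj` and (K3) `cover` of the simultaneous representatives). -/
theorem toCoverQuot_bijective {ℓ : ℕ} (S : SimRep X q ℓ) : Function.Bijective (toCoverQuot S) := by
  constructor
  · intro i i' h
    unfold toCoverQuot at h
    obtain ⟨u, hu, e⟩ := Quotient.exact h
    exact (S.disj' i' i u hu e.symm).symm
  · intro cq
    obtain ⟨i, u, hu, e⟩ := S.cover ((cq.out : unitsHeckeSet X.ι (O := coverOrder X q) ℓ) : GL (Fin 2) ℝ) cq.out.2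
    refine ⟨i, ?_⟩
    rw [← Quotient.out_eq cq]
    unfold toCoverQuot
    have hr : (unitsHeckeSetoid X.ι (isOrder_coverOrder X q) ℓ).r cq.out ⟨S.α i, α_mem_unitsHeckeSet_cover S i⟩ := ⟨u, hu, e⟩
    exact (Quotient.sound hr).symm

omit [Fact q.Prime] in
/-- **`T_ℓ^{O₀'}` on an `ι(O₀'¹)`-invariant function is `Σ_i h ∣ α_i`.** -/
theorem unitsHeckeFun_cover_eq_sum {ℓ : ℕ} (S : SimRep X q ℓ) [Fintype (Quotient (X.heckeSetoid ℓ))] (h : ℍ → ℂ)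
    (hinv : ∀ u ∈ coverUnits X q, h ∣[(2 : ℤ)] u = h) :
    unitsHeckeFun X.ι (isOrder_coverOrder X q) ℓ h = fun τ => ∑ i : Quotient (X.heckeSetoid ℓ), (h ∣[(2 : ℤ)] S.α i) τ := by
  haveI : Finite (Quotient (unitsHeckeSetoid X.ι (isOrder_coverOrder X q) ℓ)) := Finite.of_surjective _ (toCoverQuot_bijective S).2
  letI : Fintype (Quotient (unitsHeckeSetoid X.ι (isOrder_coverOrder X q) ℓ)) := Fintype.ofFinite _
  funext τ
  symm
  show ∑ i : Quotient (X.heckeSetoid ℓ), (h ∣[(2 : ℤ)] S.α i) τ = unitsHeckeFun X.ι (isOrder_coverOrder X q) ℓ h τ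
  rw [unitsHeckeFun_apply, finsum_eq_sum_of_fintype]
  apply Fintype.sum_bijective _ (toCoverQuot_bijective S)
  intro i
  obtain ⟨u, hu, e⟩ := Quotient.mk_out (s := unitsHeckeSetoid X.ι (isOrder_coverOrder X q) ℓ)
    (⟨S.α i, α_mem_unitsHeckeSet_cover S i⟩ : unitsHeckeSet X.ι (O := coverOrder X q) ℓ)
  dsimp only at e
  show (h ∣[(2 : ℤ)] S.α i) τ =
    (h ∣[(2 : ℤ)] (((Quotient.mk (unitsHeckeSetoid X.ι (isOrder_coverOrder X q) ℓ) ⟨S.α i, α_mem_unitsHeckeSet_cover S i⟩).out :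
      unitsHeckeSet X.ι (O := coverOrder X q) ℓ) : GL (Fin 2) ℝ)) τ
  conv_lhs => rw [← e, SlashAction.slash_mul, hinv u hu]

/-- **`T_ℓ^{O_s}` on an `ι(O₀'¹)`-invariant form of split-Cartan level is `Σ_i F ∣ α_i`** (§I.3 `heckeFn_dockTorus_split_one`: it is `Σ_i F ∣ δ_i`,
`δ_i = wit_i⁻¹ α_i` with `wit_i ∈ ι(O₀'¹)`; invariance removes `wit_i⁻¹`). -/
theorem unitsHeckeFun_Os_eq_sum (R : CoverReduction X q) (hq : q ∈ C) (Os : Submodule ℤ X.B) (hOs : Brandt.IsOrder X.B Os)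
    (hpres : ∀ m : Matrix (Fin 2) (Fin 2) ℝ, (∃ x ∈ Os, X.ι x = m) ↔
      ∃ y : coverSubring X q, (R.red y) 0 1 = 0 ∧ (R.red y) 1 0 = 0 ∧ X.ι (y : X.B) = m)
    {ℓ : ℕ} (S : SimRep X q ℓ) [Fintype (Quotient (X.heckeSetoid ℓ))]
    (F : CuspForm (R.levelOf (torusSubgroup (splitGen q))) 2) (hinv : ∀ u ∈ coverUnits X q, ⇑F ∣[(2 : ℤ)] u = ⇑F) :
    unitsHeckeFun X.ι hOs ℓ ⇑F = fun τ => ∑ i : Quotient (X.heckeSetoid ℓ), (⇑F ∣[(2 : ℤ)] S.α i) τ := by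
  rw [← S.heckeFn_dockTorus_split_one R hq Os hOs hpres F, SimRep.heckeFn_def]
  have hterm : ∀ i : Quotient (X.heckeSetoid ℓ),
      ⇑((R.dockTorus (torusSubgroup (splitGen q)) F).1 (S.c R i * 1)) ∣[(2 : ℤ)] (S.α i) = ⇑F ∣[(2 : ℤ)] (S.α i) := by
    intro i
    have hw : (R.redHom (S.wit R hq i))⁻¹ * (S.c R i * 1) ∈ torusSubgroup (splitGen q) := by
      rw [mul_one]; exact S.wit_spec R hq i
    rw [R.dockTorus_apply_of_witness _ _ hw, coverRep_apply, coe_coverSlash, CoverReduction.coe_restrictLevel,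
      hinv _ ((coverUnits X q).inv_mem (S.wit R hq i).2)]
  simp_rw [hterm]
  funext τ
  rw [Finset.sum_apply]

/-- **HECKE COMPATIBILITY.** On an `ι(O₀'¹)`-invariant form of split-Cartan level the Hecke operators of `O₀'` and of `O_s` agree at every good prime. -/
theorem unitsHeckeFun_cover_eq_Os (R : CoverReduction X q) (hq : q ∈ C) (Os : Submodule ℤ X.B) (hOs : Brandt.IsOrder X.B Os)
    (hpres : ∀ m : Matrix (Fin 2) (Fin 2) ℝ, (∃ x ∈ Os, X.ι x = m) ↔
      ∃ y : coverSubring X q, (R.red y) 0 1 = 0 ∧ (R.red y) 1 0 = 0 ∧ X.ι (y : X.B) = m)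
    {ℓ : ℕ} (hℓ : ℓ.Prime) (hgood : ¬ ℓ ∣ q * (D * M * ∏ p ∈ C, p))
    (F : CuspForm (R.levelOf (torusSubgroup (splitGen q))) 2) (hinv : ∀ u ∈ coverUnits X q, ⇑F ∣[(2 : ℤ)] u = ⇑F) :
    unitsHeckeFun X.ι (isOrder_coverOrder X q) ℓ ⇑F = unitsHeckeFun X.ι hOs ℓ ⇑F := by
  obtain ⟨S⟩ := nonempty_simRep (X := X) hq hℓ hgood
  letI := fintypeQuot X hℓ (good_of_good hgood)
  rw [unitsHeckeFun_cover_eq_sum S ⇑F hinv, unitsHeckeFun_Os_eq_sum R hq Os hOs hpres S F hinv]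

/-! #### §K.3 The invariant form as a cusp form on the cover group `ι(O₀'¹)` -/

/-- a form on `Γ̄(q)` fixed by `ρ(γ)` for every `γ ∈ ι(O₀'¹)` IS a cusp form of level `ι(O₀'¹)` (cusps transfer along the finite-index inclusion `Γ̄(q) ≤ ι(O₀'¹)`). -/
def coverForm (F₀ : CuspForm (principalLevel X q) 2) (hF₀ : ∀ γ : coverUnits X q, coverRep X q γ F₀ = F₀) : CuspForm (coverUnits X q) 2 where
  toFun := F₀
  slash_action_eq' A hA := by
    have h := congrArg (fun G : CuspForm (principalLevel X q) 2 => (⇑G : ℍ → ℂ)) (hF₀ (⟨A, hA⟩⁻¹))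
    simpa [coverRep_apply, coe_coverSlash] using h
  holo' := F₀.holo'
  zero_at_cusps' hc := F₀.zero_at_cusps'
    ((isCusp_iff_of_relIndex_ne_zero (principalLevel_le_coverUnits X q)
      (PrintClauses.finiteIndex_principalLevel_subgroupOf X q (Fact.out : q.Prime).ne_zero).index_ne_zero _).mpr hc)

@[simp] theorem coe_coverForm (F₀ : CuspForm (principalLevel X q) 2) (hF₀ : ∀ γ : coverUnits X q, coverRep X q γ F₀ = F₀) :
    ⇑(coverForm F₀ hF₀) = ⇑F₀ := rfl

/-! #### §K.4 (LL) PROVED from (DS) ∧ (JLᶜ) -/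

/-- **(LL) `NoCoverInvariantEigenform` from (JLᶜ) ∧ (DS).** A good-Hecke `a_ℓ(V)`-eigenform `F` of split-Cartan level (`T_ℓ^{O_s}`) whose restriction to `Γ̄(q)` is
`ι(O₀'¹)`-invariant is a cusp form on `ι(O₀'¹)` (§K.3) and a `T_ℓ^{O₀'}`-eigenform with the same eigenvalues (§K.2); if `F ≠ 0`, (JLᶜ) gives a newform `f ∈ S₂(Γ₁(M_f))`,
`ε_f = 1`, `M_f ∣ D·M·∏_{C∖q} p²` (so `q ∤ M_f`), `a_ℓ(f) = a_ℓ(V)` at almost all `ℓ` — impossible by §K.1. -/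
theorem noCoverInvariantEigenform_of_facts (h61 : DeligneSerre1974.thm61_exists_adicGaloisRep) (hJL : jacquetLanglands_cartanCover_newform) :
    NoCoverInvariantEigenform := by
  intro V _ _ hS N D M C q _ X hq R hN hDMC hq3 _hq3N _hc Os hOs hpres F hE hfix
  classical
  by_contra hF0
  have hqp : q.Prime := Fact.out
  -- invariance of `⇑F` under the cover group
  have hinv : ∀ u ∈ coverUnits X q, ⇑F ∣[(2 : ℤ)] u = ⇑F := by
    intro u hu
    have h := congrArg (fun G : CuspForm (principalLevel X q) 2 => (⇑G : ℍ → ℂ)) (hfix (⟨u, hu⟩⁻¹))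
    simpa [coverRep_apply, coe_coverSlash, CoverReduction.coe_restrictLevel] using h
  -- the form on the cover group
  set F' : CuspForm (coverUnits X q) 2 := coverForm (R.restrictLevel (torusSubgroup (splitGen q)) F) hfix with hF'def
  have hF'coe : (⇑F' : ℍ → ℂ) = ⇑F := rfl
  have hF'0 : (⇑F' : ℍ → ℂ) ≠ 0 := by
    rw [hF'coe]
    intro h0
    exact hF0 (DFunLike.ext' h0)
  -- good-Hecke eigenform on the cover
  have hN0 : q * (D * M * ∏ p ∈ C, p) ≠ 0 := by
    have hDM : D * M ≠ 0 := fun h ↦ (X.coprime q hq).2 (h ▸ dvd_zero q)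
    exact mul_ne_zero hqp.ne_zero (mul_ne_zero hDM (Finset.prod_ne_zero_iff.mpr fun p hp ↦ (X.coprime p hp).1.ne_zero))
  set S₁ : Finset ℕ := (q * (D * M * ∏ p ∈ C, p)).primeFactors with hS₁
  have hgoodS : ∀ ℓ : ℕ, ℓ.Prime → ℓ ∉ S₁ → ¬ ℓ ∣ q * (D * M * ∏ p ∈ C, p) := fun ℓ hℓ hℓS h ↦
    hℓS (Nat.mem_primeFactors.mpr ⟨hℓ, h, hN0⟩)
  have heig : ∀ ℓ : ℕ, ℓ.Prime → ℓ ∉ S₁ →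
      unitsHeckeFun X.ι (isOrder_coverOrder X q) ℓ ⇑F' = fun τ => ((V.LFunction ℓ : ℤ) : ℂ) * F' τ := by
    intro ℓ hℓ hℓS
    rw [hF'coe, unitsHeckeFun_cover_eq_Os R hq Os hOs hpres hℓ (hgoodS ℓ hℓ hℓS) F hinv]
    exact hE ℓ hℓ (hgoodS ℓ hℓ hℓS)
  obtain ⟨Mf, hMf, f, hdvd, hnew, hε, hcoef⟩ :=
    hJL.exists_newform1 D M C X q hq (isOrder_coverOrder X q) F' (fun ℓ ↦ ((V.LFunction ℓ : ℤ) : ℂ)) S₁ hF'0 heig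
  haveI : NeZero Mf := hMf
  exact false_of_newform_coeff_eq_lFunction h61 hS hq hN hDMC hq3 hnew hε (CartanCarayol.not_dvd_of_dvd_coverLevel X hq hdvd) S₁
    (fun ℓ hℓ hℓS ↦ hcoef ℓ hℓ hℓS (hgoodS ℓ hℓ hℓS))

/-! ### §J.5 PROVED: THE CUT — (PSV) ∧ (MO1) ⟹ (BCV) and (LL) ∧ (CV♭) ∧ (MO1) ⟹ (VAN) -/

/-- **(PSV) ∧ (MO1) ⟹ (BCV)** (real proof): `W_C` is an `a_ℓ(V)`-eigenmodule ((HF♭)); (SPH) gives a `T_s`-fixed `w ≠ 0` in `W_C`, `w = dockTorus T_s F_w`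
(`exists_eigenform_of_fixed`); (MO1): `F_w = c • F`; so `ℂ[G]·v ⊓ W_C ∋ c⁻¹ • w ≠ 0` and (BGEN) puts `v ∈ W_C`. -/
theorem borelCubicEigenDocking_of_typecut (hPSV : CubicPrincipalSeriesVector) (hMO : SplitLevelMultiplicityOne) :
    BorelCubicEigenDocking := by
  intro V _ _ hS N D M C q _ X W₁ _ Q hq R hN hDMC hq3 hq3N hc hQ h1
  have hLV : V.LFunction = W₁.LFunction := LFunction_eq_of_isIsogenous_holds V W₁ hQ.1
  have hQe : ∀ ℓ : ℕ, ℓ.Prime → ¬ ℓ ∣ D * M * ∏ p ∈ C, p →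
      X.heckeFun ℓ Q.form = fun τ => ((V.LFunction ℓ : ℤ) : ℂ) * Q.form τ := by
    intro ℓ hℓ hnd
    rw [hLV]
    exact Q.hecke_eq ℓ hℓ hnd
  have hgood : ∀ ℓ : ℕ, ¬ ℓ ∣ q * (D * M * ∏ p ∈ C, p) → ¬ ℓ ∣ D * M * ∏ p ∈ C, p :=
    fun ℓ h h' => h (dvd_mul_of_dvd_right h' q)
  obtain ⟨Os, hOs, hpres⟩ := exists_splitOrder R
  obtain ⟨𝒯, hcomm, hii, hiii⟩ := coverHeckeFamilyFn_holds D M C X q hq R Os hOs hpres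
  have hWC : ∀ ℓ : ℕ, ℓ.Prime → ¬ ℓ ∣ q * (D * M * ∏ p ∈ C, p) →
      ∀ w ∈ R.spanG (R.dockNonsplit hq Q.form), 𝒯 ℓ w = ((V.LFunction ℓ : ℤ) : ℂ) • coeLin R w :=
    fun ℓ hℓ hnd => eigenFn_of_mem_spanG R (𝒯 ℓ) (hcomm ℓ) (hii ℓ hℓ hnd Q.form _ (hQe ℓ hℓ (hgood ℓ hnd)))
  -- the (PSV) datum
  obtain ⟨lam, v, F, hv0, hlam, hvb, hF0, hFE, hdock⟩ :=
    hPSV V hS N D M C q X hq R hN hDMC hq3 hq3N hc h1 Os hOs hpres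
  -- a non-zero `T_s`-fixed vector of `W_C` and its eigenform
  have huC0 : R.dockNonsplit hq Q.form ≠ 0 := dockNonsplit_form_ne_zero Q hq R
  have huCT : ∀ t ∈ CartanTorusCubeCut.torusSubgroup R.η, R.indRep t (R.dockNonsplit hq Q.form) = R.dockNonsplit hq Q.form :=
    fun t ht => R.indRep_dockNonsplit_of_mem_torus hq Q.form ht
  obtain ⟨w, hwC, hw0, hwT⟩ := exists_splitFixed_in_spanG sphericalTransfer R huC0 huCT
  obtain ⟨Fw, hwd, hFwE⟩ := exists_eigenform_of_fixed hq R Os hOs 𝒯 hiii _ hWC hwC hwT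
  -- (MO1): `F_w = c • F`
  obtain ⟨c, hcF⟩ := hMO V N D M C q X hq R hN hDMC Os hOs hpres F Fw hFE hFwE hF0
  have hwc : w = c • R.dockTorus (CartanTorusCubeCut.torusSubgroup (splitGen q)) F := by
    rw [hwd]; exact dockTorus_eq_smul_of_coe R _ hcF
  have hc0 : c ≠ 0 := by
    rintro rfl
    exact hw0 (by rw [hwc, zero_smul])
  have hu'C : R.dockTorus (CartanTorusCubeCut.torusSubgroup (splitGen q)) F ∈ R.spanG (R.dockNonsplit hq Q.form) := by
    have h' : R.dockTorus (CartanTorusCubeCut.torusSubgroup (splitGen q)) F = c⁻¹ • w := by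
      rw [hwc, smul_smul, inv_mul_cancel₀ hc0, one_smul]
    rw [h']
    exact Submodule.smul_mem _ _ hwC
  have hu'0 : R.dockTorus (CartanTorusCubeCut.torusSubgroup (splitGen q)) F ≠ 0 := by
    intro h
    exact hw0 (by rw [hwc, h, smul_zero])
  -- (BGEN)
  exact ⟨lam, v, mem_of_borelLine_meets R hlam hvb (fun g F' hF' => R.indRep_mem_spanG _ g hF') hdock hu'C hu'0, hv0, hlam, hvb⟩

/-- **(LL) ∧ (CV♭) ∧ (MO1) ⟹ (VAN)** (real proof): (VAN)₁ — `u_C` `G`-invariant ⟹ `T_s`-fixed ⟹ docking of an `O₀'¹`-invariant `a_ℓ(V)`-eigenform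
(`apply_redHom`) ⟹ zero by (LL), contradicting `dockNonsplit_form_ne_zero`; (VAN)₂ — (MO1) ⟹ (L1S) ⟹ `W_C` irreducible, so a non-zero cubic `T_η`-eigen `F ∈ W_C`
has `ℂ[G]·F = W_C ∋ dockTorus T_s F_w` (`exists_eigenform_of_fixed`), and (CV♭) gives `F = 0`. -/
theorem nonsplitTorusCubicVanishing_of_typecut (hLL : NoCoverInvariantEigenform) (hCV : NonsplitCubicVanishingFree)
    (hMO : SplitLevelMultiplicityOne) : NonsplitTorusCubicVanishing := by
  intro V _ _ hS N D M C q _ X W₁ _ Q hq R hN hDMC hq3 hq3N hc hQ h2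
  have hLV : V.LFunction = W₁.LFunction := LFunction_eq_of_isIsogenous_holds V W₁ hQ.1
  have hQe : ∀ ℓ : ℕ, ℓ.Prime → ¬ ℓ ∣ D * M * ∏ p ∈ C, p →
      X.heckeFun ℓ Q.form = fun τ => ((V.LFunction ℓ : ℤ) : ℂ) * Q.form τ := by
    intro ℓ hℓ hnd
    rw [hLV]
    exact Q.hecke_eq ℓ hℓ hnd
  have hgood : ∀ ℓ : ℕ, ¬ ℓ ∣ q * (D * M * ∏ p ∈ C, p) → ¬ ℓ ∣ D * M * ∏ p ∈ C, p :=
    fun ℓ h h' => h (dvd_mul_of_dvd_right h' q)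
  obtain ⟨Os, hOs, hpres⟩ := exists_splitOrder R
  obtain ⟨𝒯, hcomm, hii, hiii⟩ := coverHeckeFamilyFn_holds D M C X q hq R Os hOs hpres
  have hWC : ∀ ℓ : ℕ, ℓ.Prime → ¬ ℓ ∣ q * (D * M * ∏ p ∈ C, p) →
      ∀ w ∈ R.spanG (R.dockNonsplit hq Q.form), 𝒯 ℓ w = ((V.LFunction ℓ : ℤ) : ℂ) • coeLin R w :=
    fun ℓ hℓ hnd => eigenFn_of_mem_spanG R (𝒯 ℓ) (hcomm ℓ) (hii ℓ hℓ hnd Q.form _ (hQe ℓ hℓ (hgood ℓ hnd)))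
  have huC0 : R.dockNonsplit hq Q.form ≠ 0 := dockNonsplit_form_ne_zero Q hq R
  have huCT : ∀ t ∈ CartanTorusCubeCut.torusSubgroup R.η, R.indRep t (R.dockNonsplit hq Q.form) = R.dockNonsplit hq Q.form :=
    fun t ht => R.indRep_dockNonsplit_of_mem_torus hq Q.form ht
  refine ⟨?_, ?_⟩
  · -- (VAN)₁ from (LL)
    by_contra hno
    push Not at hno
    have huT : ∀ t ∈ CartanTorusCubeCut.torusSubgroup (splitGen q), R.indRep t (R.dockNonsplit hq Q.form) = R.dockNonsplit hq Q.form :=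
      fun t _ => hno t
    obtain ⟨Fc, hcd, hFcE⟩ := exists_eigenform_of_fixed hq R Os hOs 𝒯 hiii _ hWC (R.self_mem_spanG _) huT
    have hinv : ∀ γ : coverUnits X q,
        coverRep X q γ (R.restrictLevel (CartanTorusCubeCut.torusSubgroup (splitGen q)) Fc) =
          R.restrictLevel (CartanTorusCubeCut.torusSubgroup (splitGen q)) Fc := by
      intro γ
      have e3 : (R.dockNonsplit hq Q.form).1 (R.redHom γ) = (R.dockNonsplit hq Q.form).1 1 := by
        have := congrArg (fun F : R.IndCuspForm => F.1 1) (hno (R.redHom γ))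
        simpa only [CoverReduction.indRep_apply, one_mul] using this
      rw [hcd, R.apply_redHom, R.dockTorus_apply_one] at e3
      exact e3
    have hFc : Fc = 0 := hLL V hS N D M C q X hq R hN hDMC hq3 hq3N hc Os hOs hpres Fc hFcE hinv
    apply huC0
    rw [hcd, hFc, dockTorus_zero]
  · -- (VAN)₂ from (CV♭), through the irreducibility of `W_C` ((MO1) ⟹ (L1S)(a))
    intro ν F hFC hν hFT
    by_contra hF0
    obtain ⟨hNSline, -⟩ := splitFixedRankOne_of_multiplicityOne hMO V hS N D M C q X W₁ Q hq R hN hDMC hq3 hq3N hc hQ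
    have hline0 := hNSline Q.form hQe
    have hirr := irreducible_spanG_of_rankOne sphericalTransfer R huCT fun w₁ hw₁ w₂ hw₂ =>
      hline0 w₁ (Submodule.mem_sup_left hw₁) w₂ (Submodule.mem_sup_left hw₂)
    have hle : R.spanG F ≤ R.spanG (R.dockNonsplit hq Q.form) :=
      spanG_le_of_mem R (fun g F' hF' => R.indRep_mem_spanG _ g hF') hFC
    have heq : R.spanG F = R.spanG (R.dockNonsplit hq Q.form) := by
      rcases hirr (R.spanG F) hle (fun g F' hF' => R.indRep_mem_spanG F g hF') with h | h
      · exact absurd ((Submodule.eq_bot_iff _).mp h F (R.self_mem_spanG F)) hF0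
      · exact h
    obtain ⟨w, hwC, hw0, hwT⟩ := exists_splitFixed_in_spanG sphericalTransfer R huC0 huCT
    obtain ⟨Fw, hwd, hFwE⟩ := exists_eigenform_of_fixed hq R Os hOs 𝒯 hiii _ hWC hwC hwT
    have hFw0 : Fw ≠ 0 := by
      intro h
      apply hw0
      rw [hwd, h, dockTorus_zero]
    have hwF : R.dockTorus (CartanTorusCubeCut.torusSubgroup (splitGen q)) Fw ∈ R.spanG F := by
      rw [heq, ← hwd]; exact hwC
    exact hF0 (hCV V hS N D M C q X hq R hN hDMC hq3 hq3N hc h2 Os hOs hpres ν F Fw hν hFT hFw0 hFwE hwF)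

end TypeCut

/-! ## §4 The FOUR stubs (the ONLY sorries of this file): (MO1) [classical, HARDEST in tree], (PSV), (CV♭) [generation 23's `Q`-free leaves], (DS) ∧ (JLᶜ)
[inputs of record]. Generation 23's fifth stub (LL) is GONE: `noCoverInvariantEigenform_of_facts` (§K.4). -/

/-- (MO1) — generation 21's classical leaf (verbatim, the tree's `CartanDoubleCoset.SplitLevelMultiplicityOne`): split-level multiplicity one for `a_ℓ(V)` at the
exact conductor. CLASSICAL; HARDEST in tree; UNDECIDED-in-tree ∕ WEAKER than (ISO)♮. -/
theorem stub_splitLevelMultiplicityOne : SplitLevelMultiplicityOne := by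
  sorry

/-- (PSV) — generation 23's leaf (§J.4), `q ≡ 1 (3)`; WEAKER-in-print than (BCV); INSTRUMENTABLE; IDEA-NEEDED in tree. -/
theorem stub_cubicPrincipalSeriesVector : CubicPrincipalSeriesVector := by
  sorry

/-- (CV♭) — generation 23's leaf (§J.4), `q ≡ 2 (3)`; WEAKER-in-print than (VAN)₂; BARRIER(print) = Deligne–Carayol; INSTRUMENTABLE. -/
theorem stub_nonsplitCubicVanishingFree : NonsplitCubicVanishingFree := by
  sorry

/-- (DS) ∧ (JLᶜ) — the Galois ∕ transfer inputs OF RECORD (cite-pure; `Lines/petarea.lean` rev 8), now ALSO the inputs of §K.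
[cite: DeligneSerre1974, Thm. 6.1] [cite: JacquetLanglands1970, Thm. 16.1] -/
theorem stub_galoisTransferInputs :
    DeligneSerre1974.thm61_exists_adicGaloisRep ∧ Literature.NumberTheory.Automorphic.jacquetLanglands_cartanCover_newform := by
  sorry

/-! ## §5 Composition — the crux decls BY NAME and NUM♮ (real proofs, no sorry): (VAN) from §J.5 with (LL) supplied by §K.4, (BCV) from §J.5, (L1S) from the tree's
`splitFixedRankOne_of_multiplicityOne`, (FGT) = `cubicCharacterTables`, (ISO)♮ by `coverIsotypicComponent_of_lines'`, assembled by the TREE's `CartanNaturalChain` closers. -/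

/-- **(VAN) `NonsplitTorusCubicVanishing` from (CV♭), (MO1) and the inputs of record (DS) ∧ (JLᶜ)** — generation 23's cut with its (LL) hypothesis DISCHARGED by §K.4. -/
theorem nonsplitTorusCubicVanishing_of_conductor (hCV : NonsplitCubicVanishingFree) (hMO : SplitLevelMultiplicityOne)
    (hGT : DeligneSerre1974.thm61_exists_adicGaloisRep ∧ Literature.NumberTheory.Automorphic.jacquetLanglands_cartanCover_newform) :
    NonsplitTorusCubicVanishing :=
  nonsplitTorusCubicVanishing_of_typecut (noCoverInvariantEigenform_of_facts hGT.1 hGT.2) hCV hMO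

/-- (ISO)♮ `CartanNatural.CoverIsotypicComponent` from the FOUR statements of this node: (MO1), (PSV), (CV♭), (DS) ∧ (JLᶜ). -/
theorem coverIsotypicComponent_of_conductor (hMO : SplitLevelMultiplicityOne) (hPSV : CubicPrincipalSeriesVector) (hCV : NonsplitCubicVanishingFree)
    (hGT : DeligneSerre1974.thm61_exists_adicGaloisRep ∧ Literature.NumberTheory.Automorphic.jacquetLanglands_cartanCover_newform) :
    CartanNatural.CoverIsotypicComponent :=
  coverIsotypicComponent_of_lines' (splitFixedRankOne_of_multiplicityOne hMO) (borelCubicEigenDocking_of_typecut hPSV hMO)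
    (nonsplitTorusCubicVanishing_of_conductor hCV hMO hGT) cubicCharacterTables

/-- **THIS NODE'S COMPOSITION — THE CRUX DECL BY NAME on `ClassRecordThree` from FOUR statements**: (MO1), (PSV), (CV♭), ((DS) ∧ (JLᶜ)). -/
theorem CartanOnePlaceDegreeLawAtThree_of_conductor :
    SplitLevelMultiplicityOne → CubicPrincipalSeriesVector → NonsplitCubicVanishingFree →
      (DeligneSerre1974.thm61_exists_adicGaloisRep ∧ Literature.NumberTheory.Automorphic.jacquetLanglands_cartanCover_newform) →
      Summit.BirchSwinnertonDyer.BirchSwinnertonDyer.Theses.ClassRecordThree.CartanOnePlaceDegreeLawAtThree :=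
  fun hMO hPSV hCV hGT ↦
    classRecordThree_cartanOnePlaceDegreeLawAtThree_of_printInputsThreeNatural ⟨coverIsotypicComponent_of_conductor hMO hPSV hCV hGT, hGT⟩

/-- **THE CRUX DECL BY NAME on `KolyvaginRoadThree`** (twin) from the same four statements. -/
theorem CartanOnePlaceDegreeLawAtThree_of_conductor' :
    SplitLevelMultiplicityOne → CubicPrincipalSeriesVector → NonsplitCubicVanishingFree →
      (DeligneSerre1974.thm61_exists_adicGaloisRep ∧ Literature.NumberTheory.Automorphic.jacquetLanglands_cartanCover_newform) →
      Summit.BirchSwinnertonDyer.BirchSwinnertonDyer.Theses.KolyvaginRoadThree.CartanOnePlaceDegreeLawAtThree :=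
  fun hMO hPSV hCV hGT ↦
    kolyvaginRoadThree_cartanOnePlaceDegreeLawAtThree_of_printInputsThreeNatural ⟨coverIsotypicComponent_of_conductor hMO hPSV hCV hGT, hGT⟩

/-- **The NUM♮ ITEM decl (32276) on `ClassRecordThree`** from the four statements. -/
theorem CartanOnePlaceDegreeLawAtThreeNatural_of_conductor :
    SplitLevelMultiplicityOne → CubicPrincipalSeriesVector → NonsplitCubicVanishingFree →
      (DeligneSerre1974.thm61_exists_adicGaloisRep ∧ Literature.NumberTheory.Automorphic.jacquetLanglands_cartanCover_newform) →
      Summit.BirchSwinnertonDyer.BirchSwinnertonDyer.Theses.ClassRecordThree.CartanOnePlaceDegreeLawAtThreeNatural :=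
  fun hMO hPSV hCV hGT ↦
    cartanOnePlaceDegreeLawAtThreeNatural_of_printInputsThree ⟨coverIsotypicComponent_of_conductor hMO hPSV hCV hGT, hGT⟩

/-- The crux decl from the four STUBS (closes modulo exactly the four sorries of §4; for the audit). -/
theorem CartanOnePlaceDegreeLawAtThree_of_stubs :
    Summit.BirchSwinnertonDyer.BirchSwinnertonDyer.Theses.ClassRecordThree.CartanOnePlaceDegreeLawAtThree :=
  CartanOnePlaceDegreeLawAtThree_of_conductor stub_splitLevelMultiplicityOne stub_cubicPrincipalSeriesVector
    stub_nonsplitCubicVanishingFree stub_galoisTransferInputs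

/-- The `KolyvaginRoadThree` twin from the four STUBS. -/
theorem CartanOnePlaceDegreeLawAtThree_of_stubs' :
    Summit.BirchSwinnertonDyer.BirchSwinnertonDyer.Theses.KolyvaginRoadThree.CartanOnePlaceDegreeLawAtThree :=
  CartanOnePlaceDegreeLawAtThree_of_conductor' stub_splitLevelMultiplicityOne stub_cubicPrincipalSeriesVector
    stub_nonsplitCubicVanishingFree stub_galoisTransferInputs

end Summit.BirchSwinnertonDyer.BirchSwinnertonDyer.Cruxes.CartanOnePlaceDegreeLawAtThree.Conductor

end
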